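import Literature.MathematicalPhysics.QuantumFieldTheory.Balaban1983to89.B4TorusKernel

/-!
# `Balaban1983to89.B5Eq129CoshWeightPairedShift` — T. Bałaban, *Propagators and renormalization transformations for lattice gauge theories. I*, Commun. Math.
# Phys. **95** (1984) 17–40 [Balaban1984PropagatorsI] p. 36 (exponential weights, «q ∈ R^d sufficiently small»), serving [Balaban1985BackgroundPropagators] Thm 3.1
# (3.42) p. 397 (the decay weight of the `|∇G|` line): **THE PAIRED OFF-SLICE SHIFT LETTER OF THE `cosh` WEIGHT FACTOR ON `ℤ∕N` —
# `cosh(a·d(c−s)) + cosh(a·d(c+s−1)) ≤ (2∕(1+e^{−a}))·cosh(a·d(c))·(cosh(a·d(s)) + cosh(a·d(s−1)))`, `d = dist(·, Nℤ)`, every `N ≥ 2`, `a ≥ 0`, `c, s ∈ ℤ`** — summing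
# the centred one-dimensional weight over the REFLECTION ORBIT `{s, 1 − s}` of a bond-difference kernel costs at most the factor `2∕(1+e^{−a}) = e^{a∕2}∕cosh(a∕2)` against
# the ON-SLICE pair sum times the weight AT THE SOURCE, uniformly in the period; the one-sided letter `B5Eq129CoshWeightFactorLetters.cosh_circAbs_add_le` ∕
# `cosh_factor_le_exp_mul_centre` pays `e^{a·d(s)}` instead (unbounded in the tail, the additive `sinh a∕(ηλ)` surcharge of the every-centre letter of
# `B5Eq129FreeResolventWeightedGradientRowCosh.sum_weight_mul_abs_sub_le` that does not vanish as `η → 0`)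

statement-level skeleton of published theorems with citation tags; proofs where landed; nothing here is a claim about the Yang–Mills mass gap

CITATION HEADER (lean-in-tree rule).  Audit cell `pub-balaban`, sub-cell `t4`, BINDER row NE9; filed by NE9 crux-team LEAF PROVER 05
(`b2b-balaban-t4-ne9-formalise-leaf-05`, gen 82).  MATHEMATICS: t4-ne9-idea-1 (NE9 crux ideation lens 1), gen 136, N37 `t4/ideate/NE9/lens1-g136/PAIRED-SHIFT-LETTER-g136.md`
1533a138dc3083f4, certificate `lean/PairedShiftLetterTorus_g136.NOT-TO-FILE.lean` 40beafb939fd388b (farm rc 0, trio; mutant M2 rc 1) — THIS FILE IS THAT CERTIFICATE, ported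
to the tree's namespace with docstrings and citation tags (helper lemmas `private`); credit theirs.  OBJECT: [Balaban1984PropagatorsI] p. 36's exponential weight in the
product-`cosh` form of the OWNER's `B5Eq129CoshSupersolution` (`W_c(y) = Π_μ cosh(a·circAbs(N μ)((c μ − y μ).val))`), one factor, on `ℤ∕N` in the `circAbs` vocabulary of
`B4TorusKernel.MultiPeriod`; nothing of print is asserted ([folklore] hyperbolic trigonometry + representatives mod `N`).

WHY THIS FILE (cell context; t4-ne9-idea-1 g135 N36 ∕ g136 N37).  On `ℤ^d` the every-centre weighted ∇-row of the free resolvent kernel exceeds the on-slice one by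
EXACTLY `2∕(1+e^{−κη})` (N36); on the torus this lineage's (W-1′) letter reaches every centre by the one-sided shift and pays the `exp` bracket
(`B5Eq129CycleWeightedMass.exp_bracket_le_uniform`: `(1+e^{−a})G(0) + 2 sinh a∕λ`) instead of the `cosh` bracket (`cosh_bracket_le_uniform`: `(1+e^{−a})G(0) + sinh a∕λ`):
numbers (d, m, κ) = (4, 1, ¼), `η = ½ → 0`: 1.688 → 1.776 (exp road) vs 1.438 → 1.443 (paired) vs exact 1.251 → 1.202 (g136 toys, 177 112 torus cases, 0 violations).  The
sequel `B5Eq129FreeResolventWeightedGradientRowPaired` pairs the reflection orbit `x ↦ R_ν x + e_ν` of `Tor N` (under which the transverse weight and `|k(x−e_ν) − k(x)|` are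
invariant) and applies this letter factorwise, then (W-0).  Zero rank weight: the every-centre factor never decides storey J's `θ < 1` (N36 (d)).

WHAT IS PROVED (sorry-free; 0 `def`; [folklore]).
* §1 the line: **`two_div_mul_cosh_half`** (`(2∕(1+e^{−a}))cosh(a∕2) = e^{a∕2}`), **`paired_shift_letter_line`** (all real `c, s`; `a ≥ 0`).
* §2 torus bookkeeping (private): monotonicity of `cosh(a·)` in `|·|`, representatives (`circAbs N z ≤ |z + Nk|`), near-maximality off a half-lattice point, and
  `good_rep` — off the fixed point `2s ≡ 1 (mod N)` a representative `S ≡ s` with `|S| = d(s)` AND `|S − 1| = d(s − 1)`; **`one_le_two_div`**.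
* §3 **`paired_shift_letter_torus`** (`2 ≤ N`, `0 ≤ a`, `c s : ℤ`).
HONEST SCOPE.  One factor, one dimension; no kernel, no sum over the torus; the consumer is the sequel.  NOT summit progress (cell pub-balaban: NE9 NOT PRINTED ∕ NOT PROVED;
«NE9 ⇐ the named binders»; row WALLED ON A MODEL (O-NE9-1; #5 UNRULED); spine PROVED 0∕9; rung (B)+1 finite T⁴ — NOT infinite volume, NOT mass gap, NOT BetaPertH, NOT Clay).
HONEST DEPENDENCY (cell line): continuum YM on T⁴ ⇐ BetaPertH ∧ nine spine estimates (0/9 proved); BetaPertH ⇐ (D1) ∧ (D4) ∧ CAP+tail; G-an2-4 gates asym, D1 and NE2/3/4.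
NEW file importing `B4TorusKernel` only; nothing modified.  Net new unproved facts: 0.
-/

noncomputable section

namespace Literature.MathematicalPhysics.QuantumFieldTheory.Balaban1983to89.B5Eq129CoshWeightPairedShift

open Real
open B4TorusKernel.MultiPeriod (circAbs centre circAbs_nonneg two_mul_circAbs_le circAbs_add_mul abs_add_mul_centre circAbs_of_centred circAbs_le_abs)

/-! ## §1 the line letter (copied from the companion file so that this file is self-contained) -/

/-- `|sinh x| ≤ cosh x`. [folklore] -/
private theorem abs_sinh_le_cosh (x : ℝ) : |Real.sinh x| ≤ Real.cosh x := by
  rw [abs_le]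
  constructor
  · have h := Real.cosh_add_sinh x
    have hp := Real.exp_pos x
    linarith
  · have h := Real.cosh_sub_sinh x
    have hp := Real.exp_pos (-x)
    linarith

/-- the half-step shift costs at most `e^{a∕2}`: `cosh(x − a∕2) ≤ e^{a∕2}·cosh x` for `a ≥ 0`. [folklore] -/
private theorem cosh_sub_half_le {a : ℝ} (ha : 0 ≤ a) (x : ℝ) :
    Real.cosh (x - a / 2) ≤ Real.exp (a / 2) * Real.cosh x := by
  rw [Real.cosh_sub, ← Real.cosh_add_sinh (a / 2)]
  have h1 : |Real.sinh x| ≤ Real.cosh x := abs_sinh_le_cosh x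
  have h2 : 0 ≤ Real.sinh (a / 2) := Real.sinh_nonneg_iff.mpr (by linarith)
  have h3 : -(Real.sinh x * Real.sinh (a / 2)) ≤ Real.cosh x * Real.sinh (a / 2) := by
    have : -Real.sinh x ≤ Real.cosh x := by
      have := neg_abs_le (Real.sinh x); linarith
    nlinarith
  nlinarith [Real.cosh_pos x, Real.cosh_pos (a / 2)]

/-- `(2∕(1+e^{−a}))·cosh(a∕2) = e^{a∕2}` — the sharp constant of the paired letter (t4-ne9-idea-1 g135 N36 `exp_half_div_cosh_half`). [folklore]
[cite: Balaban1984PropagatorsI, p.36] -/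
theorem two_div_mul_cosh_half (a : ℝ) :
    2 / (1 + Real.exp (-a)) * Real.cosh (a / 2) = Real.exp (a / 2) := by
  have hpos : 0 < 1 + Real.exp (-a) := by positivity
  rw [Real.cosh_eq, div_mul_eq_mul_div, div_eq_iff hpos.ne']
  have h1 : Real.exp (a / 2) * Real.exp (-a) = Real.exp (-(a / 2)) := by
    rw [← Real.exp_add]; congr 1; ring
  nlinarith [h1]

/-- product formula `cosh(X − Y) + cosh(X + Y) = 2·cosh X·cosh Y`. [folklore] -/
private theorem cosh_sub_add_cosh_add (X Y : ℝ) :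
    Real.cosh (X - Y) + Real.cosh (X + Y) = 2 * Real.cosh X * Real.cosh Y := by
  rw [Real.cosh_sub, Real.cosh_add]; ring

/-- **THE PAIRED OFF-SLICE SHIFT LETTER ON THE LINE**: for `a ≥ 0` and all real `c`, `s`,
`cosh(a(c−s)) + cosh(a(c+s−1)) ≤ (2∕(1+e^{−a}))·cosh(ac)·(cosh(as) + cosh(a(s−1)))` — summing the centred weight over the reflection pair `{s, 1−s}` of a
bond costs at most `2∕(1+e^{−a}) = e^{a∕2}∕cosh(a∕2)` against the on-slice pair sum times the weight at the source (product formula twice +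
`cosh(x − a∕2) ≤ e^{a∕2}cosh x`; the constant is sharp as `c → +∞`).  (t4-ne9-idea-1 g136 N37, line case.) [folklore] [cite: Balaban1984PropagatorsI, p.36] -/
theorem paired_shift_letter_line {a : ℝ} (ha : 0 ≤ a) (c s : ℝ) :
    Real.cosh (a * (c - s)) + Real.cosh (a * (c + s - 1)) ≤
      2 / (1 + Real.exp (-a)) * Real.cosh (a * c) * (Real.cosh (a * s) + Real.cosh (a * (s - 1))) := by
  have hL : Real.cosh (a * (c - s)) + Real.cosh (a * (c + s - 1)) =
      2 * Real.cosh (a * c - a / 2) * Real.cosh (a * s - a / 2) := by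
    have e1 : a * (c - s) = (a * c - a / 2) - (a * s - a / 2) := by ring
    have e2 : a * (c + s - 1) = (a * c - a / 2) + (a * s - a / 2) := by ring
    rw [e1, e2, cosh_sub_add_cosh_add]
  have hR : Real.cosh (a * s) + Real.cosh (a * (s - 1)) = 2 * Real.cosh (a * s - a / 2) * Real.cosh (a / 2) := by
    have h0 := cosh_sub_add_cosh_add (a * s - a / 2) (a / 2)
    have e1 : a * (s - 1) = (a * s - a / 2) - a / 2 := by ring
    have e2 : a * s - a / 2 + a / 2 = a * s := by ring
    rw [e2] at h0
    rw [e1, add_comm]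
    exact h0
  rw [hL, hR]
  have hK : 2 / (1 + Real.exp (-a)) * Real.cosh (a * c) * (2 * Real.cosh (a * s - a / 2) * Real.cosh (a / 2)) =
      2 * (Real.exp (a / 2) * Real.cosh (a * c)) * Real.cosh (a * s - a / 2) := by
    have := two_div_mul_cosh_half a
    calc 2 / (1 + Real.exp (-a)) * Real.cosh (a * c) * (2 * Real.cosh (a * s - a / 2) * Real.cosh (a / 2))
        = 2 * (2 / (1 + Real.exp (-a)) * Real.cosh (a / 2)) * Real.cosh (a * c) * Real.cosh (a * s - a / 2) := by ring
      _ = 2 * (Real.exp (a / 2) * Real.cosh (a * c)) * Real.cosh (a * s - a / 2) := by rw [this]; ring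
  rw [hK]
  have hX : Real.cosh (a * c - a / 2) ≤ Real.exp (a / 2) * Real.cosh (a * c) := cosh_sub_half_le ha (a * c)
  have hY : 0 < Real.cosh (a * s - a / 2) := Real.cosh_pos _
  nlinarith

/-! ## §2 torus bookkeeping: monotonicity, representatives, the reflection fixed point -/

/-- `cosh(a·u) ≤ cosh(a·v)` when `|u| ≤ |v|` and `a ≥ 0`. [folklore] -/
private theorem cosh_mul_le_of_abs_le {a u v : ℝ} (ha : 0 ≤ a) (h : |u| ≤ |v|) :
    Real.cosh (a * u) ≤ Real.cosh (a * v) := by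
  rw [Real.cosh_le_cosh, abs_mul, abs_mul, abs_of_nonneg ha]
  exact mul_le_mul_of_nonneg_left h ha

/-- `cosh(a·|Z|) = cosh(a·Z)`. [folklore] -/
private theorem cosh_mul_abs (a Z : ℝ) : Real.cosh (a * |Z|) = Real.cosh (a * Z) := by
  rw [← Real.cosh_abs (a * |Z|), ← Real.cosh_abs (a * Z), abs_mul, abs_mul, abs_abs]

/-- `1 ≤ 2∕(1+e^{−a})` for `a ≥ 0` (the paired constant never helps below `1`). [folklore] [cite: Balaban1984PropagatorsI, p.36] -/
theorem one_le_two_div {a : ℝ} (ha : 0 ≤ a) : 1 ≤ 2 / (1 + Real.exp (-a)) := by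
  have hpos : 0 < 1 + Real.exp (-a) := by positivity
  rw [le_div_iff₀ hpos]
  have := Real.exp_le_one_iff.mpr (show -a ≤ 0 by linarith)
  linarith

/-- the torus distance of `z` is at most the modulus of ANY integer representative `z + N·k` (cast to `ℝ`). [folklore] -/
private theorem circAbs_cast_le_abs_rep {N : ℕ} (hN : 1 ≤ N) (z k : ℤ) :
    ((circAbs N z : ℤ) : ℝ) ≤ |((z + N * k : ℤ) : ℝ)| := by
  have h1 : circAbs N (z + N * k) ≤ |z + N * k| := circAbs_le_abs hN _
  rw [circAbs_add_mul] at h1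
  have h2 : ((circAbs N z : ℤ) : ℝ) ≤ ((|z + N * k| : ℤ) : ℝ) := by exact_mod_cast h1
  rwa [Int.cast_abs] at h2

/-- off a half-lattice point the torus distance is nearly maximal: `2z = N·k ± 1 ⇒ N − 1 ≤ 2·circAbs N z`. [folklore] -/
private theorem sub_one_le_two_mul_circAbs {N : ℕ} (hN : 1 ≤ N) {z k e : ℤ} (he : e = 1 ∨ e = -1)
    (h : 2 * z = N * k + e) : (N : ℤ) - 1 ≤ 2 * circAbs N z := by
  have hZ : |z + N * centre N z| = circAbs N z := abs_add_mul_centre hN z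
  set m := centre N z with hm
  have h2 : 2 * (z + N * m) = N * (k + 2 * m) + e := by linear_combination h
  set j := k + 2 * m with hj
  have hN0 : (0 : ℤ) ≤ N := by positivity
  rcases lt_trichotomy j 0 with hj0 | hj0 | hj0
  · have : (N : ℤ) * j ≤ -N := by nlinarith
    have hle : z + N * m ≤ 0 := by rcases he with he | he <;> subst he <;> linarith
    rw [abs_of_nonpos hle] at hZ
    rcases he with he | he <;> subst he <;> linarith
  · rw [hj0, mul_zero, zero_add] at h2
    rcases he with he | he <;> subst he <;> omega
  · have : (N : ℤ) ≤ N * j := by nlinarith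
    have hge : 0 ≤ z + N * m := by rcases he with he | he <;> subst he <;> linarith
    rw [abs_of_nonneg hge] at hZ
    rcases he with he | he <;> subst he <;> linarith

/-- OFF the reflection fixed point `2s ≡ 1 (mod N)` there is a representative `S ≡ s` with BOTH `S` and `S − 1` centred:
`|S| = circAbs N s` and `|S − 1| = circAbs N (s − 1)`. [folklore] -/
private theorem good_rep {N : ℕ} (hN : 2 ≤ N) (s : ℤ) (hs : ∀ k : ℤ, 2 * s - 1 ≠ N * k) :
    ∃ S : ℤ, (∃ k : ℤ, S = s + N * k) ∧ |S| = circAbs N s ∧ |S - 1| = circAbs N (s - 1) := by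
  have hN1 : 1 ≤ N := by omega
  have hZ : |s + N * centre N s| = circAbs N s := abs_add_mul_centre hN1 s
  set m := centre N s with hm
  set S₀ := s + N * m with hS₀
  have h2 : 2 * |S₀| ≤ N := by rw [hZ]; exact two_mul_circAbs_le N s
  have hper : circAbs N (S₀ - 1) = circAbs N (s - 1) := by
    have e : S₀ - 1 = (s - 1) + N * m := by rw [hS₀]; ring
    rw [e, circAbs_add_mul]
  by_cases hc : 2 * |S₀ - 1| ≤ N
  · refine ⟨S₀, ⟨m, rfl⟩, hZ, ?_⟩
    rw [← hper, circAbs_of_centred hN1 hc]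
  · -- then `2·S₀ = −N`: the other boundary value `2·S₀ = 1 − N` is the excluded fixed point
    have ha1 := le_abs_self S₀
    have ha2 := neg_abs_le S₀
    have hb : |S₀ - 1| = S₀ - 1 ∨ |S₀ - 1| = -(S₀ - 1) := abs_choice (S₀ - 1)
    have hx : 2 * s - 1 ≠ -(N : ℤ) - 2 * ((N : ℤ) * m) := by
      intro h
      exact hs (-(1 + 2 * m)) (by rw [h]; ring)
    have h5 : 2 * S₀ = -N := by
      rcases hb with hb | hb <;> rw [hb] at hc <;> push Not at hc <;> omega
    refine ⟨S₀ + N, ⟨m + 1, by rw [hS₀]; ring⟩, ?_, ?_⟩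
    · rw [← hZ]
      have hle : S₀ ≤ 0 := by omega
      have hge : 0 ≤ S₀ + N := by omega
      rw [abs_of_nonpos hle, abs_of_nonneg hge]; omega
    · have e : S₀ + N - 1 = (S₀ - 1) + N * 1 := by ring
      have hcen : 2 * |S₀ + N - 1| ≤ N := by
        have hge : 0 ≤ S₀ + N - 1 := by omega
        rw [abs_of_nonneg hge]; omega
      rw [← hper, ← circAbs_of_centred hN1 hcen, e, circAbs_add_mul]

/-! ## §3 the torus letter -/

/-- **THE PAIRED OFF-SLICE SHIFT LETTER ON THE TORUS** (`N ≥ 2`, `a ≥ 0`, all `c s : ℤ`; `d = circAbs N = dist(·, Nℤ)`):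
`cosh(a·d(c−s)) + cosh(a·d(c+s−1)) ≤ (2∕(1+e^{−a}))·cosh(a·d(c))·(cosh(a·d(s)) + cosh(a·d(s−1)))` — period-uniform.  Off the reflection fixed point
`2s ≡ 1 (mod N)`: representatives with `C`, `S`, `S − 1` all centred, the line letter at `(C, S)` and `d ≤ |representative|`; AT the fixed point `d(s) = d(s−1)`
is (nearly) maximal, so the left side is below the on-slice pair and `2∕(1+e^{−a})·cosh ≥ 1`.  Against the tree's one-sided shift
`B5Eq129CoshWeightFactorLetters.cosh_circAbs_add_le` (`cosh(a·d(u+v)) ≤ e^{a·d(u)}cosh(a·d(v))`, unbounded in the tail) this is the letter that keeps the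
every-centre weighted ∇-row of `B5Eq129FreeResolventWeightedGradientRowCosh` within the factor `2∕(1+e^{−a})` of the on-slice `cosh` bracket.
(t4-ne9-idea-1 g136 N37.) [folklore] [cite: Balaban1984PropagatorsI, p.36; Balaban1985BackgroundPropagators, Thm 3.1 (3.42) p.397] -/
theorem paired_shift_letter_torus {N : ℕ} (hN : 2 ≤ N) {a : ℝ} (ha : 0 ≤ a) (c s : ℤ) :
    Real.cosh (a * ((circAbs N (c - s) : ℤ) : ℝ)) + Real.cosh (a * ((circAbs N (c + s - 1) : ℤ) : ℝ)) ≤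
      2 / (1 + Real.exp (-a)) * Real.cosh (a * ((circAbs N c : ℤ) : ℝ)) *
        (Real.cosh (a * ((circAbs N s : ℤ) : ℝ)) + Real.cosh (a * ((circAbs N (s - 1) : ℤ) : ℝ))) := by
  have hN1 : 1 ≤ N := by omega
  have hK : 1 ≤ 2 / (1 + Real.exp (-a)) := one_le_two_div ha
  -- abbreviations for the five distances (as reals) and their ranges
  have hd0 : ∀ z : ℤ, (0 : ℝ) ≤ ((circAbs N z : ℤ) : ℝ) := fun z => by exact_mod_cast circAbs_nonneg hN1 z
  by_cases hfp : ∃ k : ℤ, 2 * s - 1 = N * k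
  · -- AT the reflection fixed point: `d(s) = d(s−1)` is (nearly) maximal, every distance is below it
    obtain ⟨k, hk⟩ := hfp
    have hs1 : (N : ℤ) - 1 ≤ 2 * circAbs N s :=
      sub_one_le_two_mul_circAbs hN1 (e := 1) (Or.inl rfl) (k := k) (by linarith)
    have hs2 : (N : ℤ) - 1 ≤ 2 * circAbs N (s - 1) :=
      sub_one_le_two_mul_circAbs hN1 (e := -1) (Or.inr rfl) (k := k) (by linarith)
    have hx := two_mul_circAbs_le N (c - s)
    have hy := two_mul_circAbs_le N (c + s - 1)
    have hx' : circAbs N (c - s) ≤ circAbs N s := by omega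
    have hy' : circAbs N (c + s - 1) ≤ circAbs N (s - 1) := by omega
    have h1 : Real.cosh (a * ((circAbs N (c - s) : ℤ) : ℝ)) ≤ Real.cosh (a * ((circAbs N s : ℤ) : ℝ)) := by
      apply cosh_mul_le_of_abs_le ha
      rw [abs_of_nonneg (hd0 _), abs_of_nonneg (hd0 _)]; exact_mod_cast hx'
    have h2 : Real.cosh (a * ((circAbs N (c + s - 1) : ℤ) : ℝ)) ≤ Real.cosh (a * ((circAbs N (s - 1) : ℤ) : ℝ)) := by
      apply cosh_mul_le_of_abs_le ha
      rw [abs_of_nonneg (hd0 _), abs_of_nonneg (hd0 _)]; exact_mod_cast hy'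
    have hQ : 0 ≤ Real.cosh (a * ((circAbs N s : ℤ) : ℝ)) + Real.cosh (a * ((circAbs N (s - 1) : ℤ) : ℝ)) := by
      have := Real.cosh_pos (a * ((circAbs N s : ℤ) : ℝ))
      have := Real.cosh_pos (a * ((circAbs N (s - 1) : ℤ) : ℝ))
      linarith
    have hKc : 1 ≤ 2 / (1 + Real.exp (-a)) * Real.cosh (a * ((circAbs N c : ℤ) : ℝ)) :=
      one_le_mul_of_one_le_of_one_le hK (Real.one_le_cosh _)
    calc Real.cosh (a * ((circAbs N (c - s) : ℤ) : ℝ)) + Real.cosh (a * ((circAbs N (c + s - 1) : ℤ) : ℝ))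
        ≤ Real.cosh (a * ((circAbs N s : ℤ) : ℝ)) + Real.cosh (a * ((circAbs N (s - 1) : ℤ) : ℝ)) := by linarith
      _ ≤ 2 / (1 + Real.exp (-a)) * Real.cosh (a * ((circAbs N c : ℤ) : ℝ)) *
          (Real.cosh (a * ((circAbs N s : ℤ) : ℝ)) + Real.cosh (a * ((circAbs N (s - 1) : ℤ) : ℝ))) :=
          le_mul_of_one_le_left hQ hKc
  · -- OFF the fixed point: representatives `C` (centred) and `S` (with `S`, `S−1` centred), then the line letter at `(C, S)`
    push Not at hfp
    obtain ⟨S, ⟨ks, hS⟩, hSabs, hS1abs⟩ := good_rep hN s hfp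
    have hC : |c + N * centre N c| = circAbs N c := abs_add_mul_centre hN1 c
    set C := c + N * centre N c with hCdef
    -- left side ≤ line left side at (C, S)
    have h1 : Real.cosh (a * ((circAbs N (c - s) : ℤ) : ℝ)) ≤ Real.cosh (a * ((C : ℝ) - (S : ℝ))) := by
      apply cosh_mul_le_of_abs_le ha
      rw [abs_of_nonneg (hd0 _)]
      have := circAbs_cast_le_abs_rep hN1 (c - s) (centre N c - ks)
      have e : (((c - s) + N * (centre N c - ks) : ℤ) : ℝ) = (C : ℝ) - (S : ℝ) := by
        rw [hCdef, hS]; push_cast; ring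
      rwa [e] at this
    have h2 : Real.cosh (a * ((circAbs N (c + s - 1) : ℤ) : ℝ)) ≤ Real.cosh (a * ((C : ℝ) + (S : ℝ) - 1)) := by
      apply cosh_mul_le_of_abs_le ha
      rw [abs_of_nonneg (hd0 _)]
      have := circAbs_cast_le_abs_rep hN1 (c + s - 1) (centre N c + ks)
      have e : (((c + s - 1) + N * (centre N c + ks) : ℤ) : ℝ) = (C : ℝ) + (S : ℝ) - 1 := by
        rw [hCdef, hS]; push_cast; ring
      rwa [e] at this
    -- right side = line right side at (C, S)
    have e0 : Real.cosh (a * (C : ℝ)) = Real.cosh (a * ((circAbs N c : ℤ) : ℝ)) := by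
      rw [← hC, Int.cast_abs, cosh_mul_abs]
    have e1 : Real.cosh (a * (S : ℝ)) = Real.cosh (a * ((circAbs N s : ℤ) : ℝ)) := by
      rw [← hSabs, Int.cast_abs, cosh_mul_abs]
    have e2 : Real.cosh (a * ((S : ℝ) - 1)) = Real.cosh (a * ((circAbs N (s - 1) : ℤ) : ℝ)) := by
      rw [← hS1abs, Int.cast_abs, cosh_mul_abs]; push_cast; ring_nf
    have h3 := paired_shift_letter_line ha (C : ℝ) (S : ℝ)
    rw [e0, e1, e2] at h3
    linarith
end Literature.MathematicalPhysics.QuantumFieldTheory.Balaban1983to89.B5Eq129CoshWeightPairedShift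

end
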